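import Literature.AlgebraicTopology.FundamentalGroup.VanKampenEpi
import Literature.AlgebraicTopology.FundamentalGroup.InclHomTransport
import HarnessLib

/-!
# `π₁` of the complement of a sphere of codimension `≥ 3` (Kosinski X.2, van Kampen form)

Topic `Literature/AlgebraicTopology/FundamentalGroup` (fact seat of
`Literature.Topology.FourManifolds.HomotopySphere.exists_highlyConnected_of_mem_signatureSet`,
brick B4).  A. Kosinski, *Differential Manifolds* (1993), Ch. X §2, proof of Thm. (2.2), p. 201,
uses that *removing an embedded sphere `S` with trivial normal bundle and codimension `≥ 3` from
a manifold `W` does not change `π₁`*, and that the surgery on `S` then does not change `π₁`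
either (`k ≥ 2`) resp. kills the class of `S` (`k = 1`).  The first statement is usually proved by
general position; here it is deduced from the Seifert–van Kampen theorem alone: `W = (W ∖ S) ∪ T`
for the open tube `T ≅ Sᵏ × ℝˡ⁺¹ ⊇ S = Sᵏ × 0`, and `π₁(T ∖ S) → π₁(T)` is an isomorphism (both are
`π₁(Sᵏ)`, the fibres `ℝˡ⁺¹ ∖ 0`, `ℝˡ⁺¹` being simply connected for `l + 1 ≥ 3`), so the pushout
`π₁(W) = π₁(W ∖ S) *_{π₁(T ∖ S)} π₁(T)` is `π₁(W ∖ S)`.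

Contents (all proved):

* `VanKampen.bijective_inclHom_of_bijective_right` — **a pushout of groups along an isomorphism
  is trivial**: in the van Kampen square of an open cover `Y = U ∪ T` (`U`, `T`, `U ∩ T` path
  connected), if `π₁(U ∩ T) → π₁(T)` is bijective then `π₁(U) → π₁(Y)` is bijective
  (Hatcher 2002, Thm. 1.20: the universal property `existsUnique_hom_of_cover` gives a retraction,
  generation `closure_range_inclHom_union_eq_top` gives surjectivity);
* `VanKampen.bijective_inclHom_prod_of_simplyConnected` — for `B ⊆ E` with `B`, `E` simply
  connected, `π₁(Z × B) → π₁(Z × E)` is bijective (products of paths and homotopies, Mathlib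
  `Path.Homotopic.prod`);
* `VanKampen.isPathConnected_compl_of_nbhd` — rerouting paths: `W ∖ S` is path connected when
  `S` is closed with an open neighbourhood `T` such that `T ∖ S` is path connected;
* `VanKampen.bijective_inclHom_compl_core`, `VanKampen.simplyConnectedSpace_compl_core_iff` —
  for an open embedding `φ : Z × E → W` (compact path-connected `Z`, Hausdorff path-connected
  `W`, `E` and `E ∖ 0` simply connected): `π₁(W ∖ φ(Z × 0)) → π₁(W)` is bijective, and
  `W ∖ φ(Z × 0)` is simply connected iff `W` is.

Everything is proved; no new definitions, no named facts.

## References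

* A. Kosinski, *Differential Manifolds* (1993), Ch. X §2, proof of Thm. (2.2), p. 201; Ch. VI §2.
  [Kosinski1993]
* A. Hatcher, *Algebraic Topology* (2002), Thm. 1.20, Prop. 1.12, Prop. 1.14. [HatcherAT2002]
-/

noncomputable section

open Set Function unitInterval Topology

namespace Literature.AlgebraicTopology.FundamentalGroup

namespace VanKampen

/-! ### A pushout along an isomorphism -/

section PushoutIso

variable {Y : Type*} [TopologicalSpace Y] {U T : Set Y} {x₀ : Y}

/-- **Van Kampen square with an isomorphic edge.**  Let `Y = U ∪ T` with `U`, `T` open,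
`x₀ ∈ U ∩ T` and `U`, `T`, `U ∩ T` path connected.  If `π₁(U ∩ T, x₀) → π₁(T, x₀)` is bijective
then `π₁(U, x₀) → π₁(Y, x₀)` is bijective: injective by the universal property of the pushout
(Hatcher, Thm. 1.20) applied to `id : π₁(U) → π₁(U)` and `π₁(T) ≅ π₁(U ∩ T) → π₁(U)`, surjective
because `π₁(Y)` is generated by the images of `π₁(U)` and `π₁(T)` (Lemma 1.15) and the latter is
contained in the former. [cite: HatcherAT2002, Thm. 1.20] -/
theorem bijective_inclHom_of_bijective_right (hUo : IsOpen U) (hTo : IsOpen T)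
    (hcov : U ∪ T = univ) (hxU : x₀ ∈ U) (hxT : x₀ ∈ T) (hUpc : IsPathConnected U)
    (hTpc : IsPathConnected T) (hmeet : IsPathConnected (U ∩ T))
    (hjT : Function.Bijective
      (inclHomOfSubset (inter_subset_right : U ∩ T ⊆ T) x₀ ⟨hxU, hxT⟩ hxT)) :
    Function.Bijective (inclHom U x₀ hxU) := by
  set jU := inclHomOfSubset (inter_subset_left : U ∩ T ⊆ U) x₀ ⟨hxU, hxT⟩ hxU with hjUdef
  set jT := inclHomOfSubset (inter_subset_right : U ∩ T ⊆ T) x₀ ⟨hxU, hxT⟩ hxT with hjTdef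
  let eT := MulEquiv.ofBijective jT hjT
  -- the cone `id : π₁(U) → π₁(U)`, `jU ∘ jT⁻¹ : π₁(T) → π₁(U)`
  have compat : ∀ (δ : Path x₀ x₀) (hU : ∀ t, δ t ∈ U) (hT : ∀ t, δ t ∈ T),
      (MonoidHom.id _) (_root_.FundamentalGroup.fromPath
          (Path.Homotopic.Quotient.mk (liftPath U δ hU))) =
        (jU.comp eT.symm.toMonoidHom) (_root_.FundamentalGroup.fromPath
          (Path.Homotopic.Quotient.mk (liftPath T δ hT))) := by
    intro δ hU hT
    have hUT : ∀ t, δ t ∈ U ∩ T := fun t => ⟨hU t, hT t⟩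
    have hT' : _root_.FundamentalGroup.fromPath (Path.Homotopic.Quotient.mk (liftPath T δ hT)) =
        jT (_root_.FundamentalGroup.fromPath
          (Path.Homotopic.Quotient.mk (liftPath (U ∩ T) δ hUT))) := by
      rw [hjTdef, inclHomOfSubset_fromPath_liftPath]
    have hU' : _root_.FundamentalGroup.fromPath (Path.Homotopic.Quotient.mk (liftPath U δ hU)) =
        jU (_root_.FundamentalGroup.fromPath
          (Path.Homotopic.Quotient.mk (liftPath (U ∩ T) δ hUT))) := by
      rw [hjUdef, inclHomOfSubset_fromPath_liftPath]
    rw [MonoidHom.id_apply, MonoidHom.comp_apply, hT', hU']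
    congr 1
    exact (eT.symm_apply_apply _).symm
  obtain ⟨Φ, ⟨hΦU, -⟩, -⟩ := existsUnique_hom_of_cover hUo hTo hcov hxU hxT hUpc hTpc hmeet
    (MonoidHom.id _) (jU.comp eT.symm.toMonoidHom) compat
  refine ⟨fun a b hab => ?_, fun g => ?_⟩
  · have h := DFunLike.congr_fun hΦU
    have ha : Φ (inclHom U x₀ hxU a) = a := h a
    have hb : Φ (inclHom U x₀ hxU b) = b := h b
    rw [← ha, ← hb, hab]
  · -- generation: the image of `π₁(T)` lies in the image of `π₁(U)`
    have hsub : Set.range (inclHom T x₀ hxT) ⊆ Set.range (inclHom U x₀ hxU) := by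
      rintro _ ⟨c, rfl⟩
      obtain ⟨d, rfl⟩ := hjT.2 c
      refine ⟨jU d, ?_⟩
      rw [hjUdef, hjTdef, inclHom_inclHomOfSubset, inclHom_inclHomOfSubset]
    have htop := closure_range_inclHom_union_eq_top hUo hTo hcov hxU hxT hUpc hTpc hmeet
    rw [union_eq_self_of_subset_right hsub, ← MonoidHom.coe_range, Subgroup.closure_eq] at htop
    have hg : g ∈ (inclHom U x₀ hxU).range := by rw [htop]; exact Subgroup.mem_top g
    exact hg

end PushoutIso

/-! ### `π₁(Z × B) → π₁(Z × E)` for simply connected `B ⊆ E` -/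

section ProdModel

variable {Z E : Type*} [TopologicalSpace Z] [TopologicalSpace E]

/-- **Thickening a simply connected fibre does not change `π₁`.**  For `B ⊆ E` with `B` and `E`
simply connected, `z₀ ∈ Z`, `v₀ ∈ B`, the inclusion `Z × B ⊆ Z × E` induces a bijection
`π₁(Z × B, (z₀, v₀)) → π₁(Z × E, (z₀, v₀))` (paths and homotopies of paths in a product are pairs:
Hatcher 2002, Prop. 1.12; both groups are `π₁(Z, z₀)`).  Used with `E = ℝˡ⁺¹`, `B = ℝˡ⁺¹ ∖ 0`,
`l + 1 ≥ 3`. [cite: HatcherAT2002, Prop. 1.12] -/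
theorem bijective_inclHom_prod_of_simplyConnected {B : Set E} [SimplyConnectedSpace E]
    [SimplyConnectedSpace ↥B] {z₀ : Z} {v₀ : E} (hv₀ : v₀ ∈ B) :
    Function.Bijective (inclHom {q : Z × E | q.2 ∈ B} (z₀, v₀) hv₀) := by
  set S₀ : Set (Z × E) := {q : Z × E | q.2 ∈ B} with hS₀
  -- the product structure of `S₀`
  let η : Z × ↥B ≃ₜ ↥S₀ :=
    { toFun := fun q ↦ ⟨(q.1, (q.2 : E)), q.2.2⟩
      invFun := fun s ↦ (s.1.1, ⟨s.1.2, s.2⟩)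
      left_inv := fun _ ↦ rfl
      right_inv := fun _ ↦ rfl
      continuous_toFun :=
        (continuous_fst.prodMk (continuous_subtype_val.comp continuous_snd)).subtype_mk _
      continuous_invFun := (continuous_fst.comp continuous_subtype_val).prodMk
        ((continuous_snd.comp continuous_subtype_val).subtype_mk _) }
  refine ⟨fun a b hab ↦ ?_, fun g ↦ ?_⟩
  · -- injectivity: compare the `Z`-components, the `B`-components are all homotopic
    induction a using PushoutData.ind_fromPath with
    | h α =>
    induction b using PushoutData.ind_fromPath with
    | h β =>
    rw [inclHom_fromPath, inclHom_fromPath] at hab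
    have hab' : Path.Homotopic.Quotient.mk (α.map continuous_subtype_val) =
        Path.Homotopic.Quotient.mk (β.map continuous_subtype_val) := hab
    -- transport to `Z × B`
    let α' : Path (z₀, (⟨v₀, hv₀⟩ : ↥B)) (z₀, ⟨v₀, hv₀⟩) := α.map η.symm.continuous
    let β' : Path (z₀, (⟨v₀, hv₀⟩ : ↥B)) (z₀, ⟨v₀, hv₀⟩) := β.map η.symm.continuous
    have hL : Path.Homotopic.projLeft (Path.Homotopic.Quotient.mk α') =
        Path.Homotopic.projLeft (Path.Homotopic.Quotient.mk β') := by
      have hα : Path.Homotopic.projLeft (Path.Homotopic.Quotient.mk α') =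
          Path.Homotopic.projLeft (Path.Homotopic.Quotient.mk (α.map continuous_subtype_val)) := by
        simp only [Path.Homotopic.projLeft, ← Path.Homotopic.Quotient.mk_map]
        rfl
      have hβ : Path.Homotopic.projLeft (Path.Homotopic.Quotient.mk β') =
          Path.Homotopic.projLeft (Path.Homotopic.Quotient.mk (β.map continuous_subtype_val)) := by
        simp only [Path.Homotopic.projLeft, ← Path.Homotopic.Quotient.mk_map]
        rfl
      rw [hα, hβ, hab']
    have hR : Path.Homotopic.projRight (Path.Homotopic.Quotient.mk α') =
        Path.Homotopic.projRight (Path.Homotopic.Quotient.mk β') := Subsingleton.elim _ _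
    have hαβ' : Path.Homotopic.Quotient.mk α' = Path.Homotopic.Quotient.mk β' := by
      rw [← Path.Homotopic.prod_projLeft_projRight (Path.Homotopic.Quotient.mk α'), hL, hR,
        Path.Homotopic.prod_projLeft_projRight]
    -- and back
    have hα : α = α'.map η.continuous :=
      Path.ext (funext fun t ↦ (η.apply_symm_apply (α t)).symm)
    have hβ : β = β'.map η.continuous :=
      Path.ext (funext fun t ↦ (η.apply_symm_apply (β t)).symm)
    have : Path.Homotopic.Quotient.mk α = Path.Homotopic.Quotient.mk β := by
      rw [hα, hβ]
      exact Path.Homotopic.Quotient.eq.2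
        ((Path.Homotopic.Quotient.eq.1 hαβ').map (η : C(Z × ↥B, ↥S₀)))
    rw [this]
  · -- surjectivity: replace the `E`-component by the constant path
    induction g using PushoutData.ind_fromPath with
    | h δ =>
    let δ₁ : Path z₀ z₀ := δ.map continuous_fst
    let δ' : Path (z₀, v₀) (z₀, v₀) := δ₁.prod (Path.refl v₀)
    have hδ' : ∀ t, δ' t ∈ S₀ := fun t ↦ hv₀
    refine ⟨_root_.FundamentalGroup.fromPath (Path.Homotopic.Quotient.mk (liftPath S₀ δ' hδ')), ?_⟩
    rw [inclHom_fromPath_liftPath]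
    -- `δ ≃ (δ₁, δ₂) ≃ (δ₁, refl)`
    have h2 : Path.Homotopic.projRight (Path.Homotopic.Quotient.mk δ) =
        Path.Homotopic.Quotient.mk (Path.refl v₀) := Subsingleton.elim _ _
    have h1 : Path.Homotopic.projLeft (Path.Homotopic.Quotient.mk δ) =
        Path.Homotopic.Quotient.mk δ₁ := by
      rw [Path.Homotopic.projLeft, ← Path.Homotopic.Quotient.mk_map]
    have : Path.Homotopic.Quotient.mk δ = Path.Homotopic.Quotient.mk δ' := by
      rw [← Path.Homotopic.prod_projLeft_projRight (Path.Homotopic.Quotient.mk δ), h1, h2,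
        Path.Homotopic.prod_lift]
    rw [this]

end ProdModel

/-! ### Rerouting paths around a closed set with a path-connected punctured neighbourhood -/

section Reroute

variable {W : Type*} [TopologicalSpace W] {S T : Set W}

/-- If a path from `x ∉ S` meets the closed set `S ⊆ T`, `T` open, then `x` is joined inside
`W ∖ S` to a point of `T ∖ S` (stop just before the first hitting time). [folklore] -/
theorem joinedIn_compl_of_path_meets (hS : IsClosed S) (hT : IsOpen T) (hST : S ⊆ T) {x y : W}
    (hx : x ∉ S) (γ : Path x y) (hmeet : ∃ t, γ t ∈ S) :
    ∃ a ∈ T \ S, JoinedIn Sᶜ x a := by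
  -- the first hitting time
  set H : Set I := {t | γ t ∈ S} with hH
  have hHc : IsClosed H := hS.preimage γ.continuous
  have hHne : H.Nonempty := hmeet
  set t₁ := sInf H with ht₁
  have ht₁H : t₁ ∈ H := hHc.sInf_mem hHne
  have hbefore : ∀ t, t < t₁ → γ t ∉ S := fun t ht hmem ↦ not_le.2 ht (sInf_le hmem)
  have h0le : (0 : I) ≤ t₁ := t₁.2.1
  have ht₁0 : (0 : I) < t₁ := by
    rcases h0le.lt_or_eq with h | h
    · exact h
    · exfalso
      have h0 : γ 0 ∈ S := by rw [h]; exact ht₁H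
      rw [γ.source] at h0
      exact hx h0
  -- an interval `(l, t₁]` mapped into `T`
  have hTn : γ ⁻¹' T ∈ 𝓝 t₁ := (hT.preimage γ.continuous).mem_nhds (hST ht₁H)
  obtain ⟨l, hl, hlT⟩ := exists_Ioc_subset_of_mem_nhds hTn ⟨0, ht₁0⟩
  obtain ⟨s, hls, hst⟩ := exists_between hl
  refine ⟨γ s, ⟨hlT ⟨hls, hst.le⟩, hbefore s hst⟩, ?_⟩
  -- the initial segment `γ|[0, s]`
  have hs0 : (0 : ℝ) ≤ s := s.2.1
  let γ₀ : Path x (γ s) := (γ.truncate 0 s).cast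
    (by rw [min_eq_left hs0, Path.extend_zero]) (by rw [Path.extend_extends'])
  refine ⟨γ₀, fun t ↦ ?_⟩
  show γ.extend (min (max (t : ℝ) 0) s) ∉ S
  have hu0 : 0 ≤ min (max (t : ℝ) 0) s := le_min (le_max_right _ _) hs0
  have hu1 : min (max (t : ℝ) 0) s ≤ 1 := (min_le_right _ _).trans s.2.2
  rw [Path.extend_apply γ ⟨hu0, hu1⟩]
  refine hbefore _ (lt_of_le_of_lt ?_ hst)
  exact Subtype.mk_le_mk.2 (min_le_right _ _)

/-- **Removing a closed set with a path-connected punctured open neighbourhood keeps a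
path-connected space path connected**: if `S ⊆ T ⊆ W`, `S` closed, `T` open, `W` path connected
and `T ∖ S` nonempty path connected, then `W ∖ S` is path connected (reroute a path through
`T ∖ S` between its first and last visits to `S`). [folklore] -/
theorem isPathConnected_compl_of_nbhd (hS : IsClosed S) (hT : IsOpen T) (hST : S ⊆ T)
    (hW : IsPathConnected (univ : Set W)) (hTS : IsPathConnected (T \ S)) :
    IsPathConnected Sᶜ := by
  obtain ⟨a₀, ha₀⟩ := hTS.nonempty
  refine ⟨a₀, ha₀.2, fun y hy ↦ ?_⟩
  -- it suffices to join every `y ∉ S` to a point of `T ∖ S` inside `Sᶜ`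
  suffices h : ∀ y, y ∉ S → ∃ a ∈ T \ S, JoinedIn Sᶜ y a by
    obtain ⟨a, ha, hya⟩ := h y hy
    exact ((hTS.joinedIn a₀ ha₀ a ha).mono fun _ h ↦ h.2).trans hya.symm
  intro y hy
  let γ : Path y a₀ := (hW.joinedIn y (mem_univ y) a₀ (mem_univ a₀)).somePath
  by_cases hmeet : ∃ t, γ t ∈ S
  · exact joinedIn_compl_of_path_meets hS hT hST hy γ hmeet
  · push Not at hmeet
    exact ⟨a₀, ha₀, ⟨γ, hmeet⟩⟩

end Reroute

/-! ### The complement of the core of a tube with simply connected punctured fibre -/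

section Core

variable {Z E W : Type*} [TopologicalSpace Z] [CompactSpace Z] [PathConnectedSpace Z]
  [NormedAddCommGroup E] [SimplyConnectedSpace E] [SimplyConnectedSpace ↥(({0} : Set E)ᶜ)]
  [TopologicalSpace W] [T2Space W] [PathConnectedSpace W] {φ : Z × E → W}

omit [TopologicalSpace Z] [CompactSpace Z] [PathConnectedSpace Z] [SimplyConnectedSpace E]
  [SimplyConnectedSpace ↥(({0} : Set E)ᶜ)] [TopologicalSpace W] [T2Space W]
  [PathConnectedSpace W] in
/-- The punctured tube is the tube minus the core. [folklore] -/
theorem image_compl_zero_eq (hφ : Function.Injective φ) :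
    φ '' {q : Z × E | q.2 ∈ (({0} : Set E)ᶜ)} = (φ '' (univ ×ˢ {0}))ᶜ ∩ range φ := by
  ext w
  constructor
  · rintro ⟨q, hq, rfl⟩
    refine ⟨?_, mem_range_self q⟩
    rintro ⟨q', ⟨-, hq'⟩, hqq'⟩
    rw [mem_singleton_iff] at hq'
    have := hφ hqq'
    subst this
    exact hq hq'
  · rintro ⟨hw, ⟨q, rfl⟩⟩
    refine ⟨q, fun hq0 ↦ hw ⟨q, ⟨mem_univ _, hq0⟩, rfl⟩, rfl⟩

omit [PathConnectedSpace Z] [SimplyConnectedSpace E] [SimplyConnectedSpace ↥(({0} : Set E)ᶜ)]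
  [PathConnectedSpace W] in
/-- The core of a tube over a compact base is closed. [folklore] -/
theorem isClosed_image_core (hφ : Continuous φ) : IsClosed (φ '' (univ ×ˢ ({0} : Set E))) :=
  ((isCompact_univ.prod isCompact_singleton).image hφ).isClosed

/-- **Removing the core of a tube with simply connected punctured fibre does not change `π₁`**
(Kosinski 1993, X.2, proof of (2.2); VI.2 for a point): for an open embedding
`φ : Z × E → W` of a tube over a compact path-connected `Z` into a path-connected Hausdorff `W`,
with `E` and `E ∖ 0` simply connected (e.g. `E = ℝᶜ`, `c ≥ 3`), and a base point `φ q₀` off the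
core `S = φ(Z × 0)`, the inclusion induces a bijection `π₁(W ∖ S, φ q₀) → π₁(W, φ q₀)`
(van Kampen for `W = (W ∖ S) ∪ φ(Z × E)` with `π₁(φ(Z × (E ∖ 0))) ≅ π₁(φ(Z × E))`).
[cite: Kosinski1993, Ch. X §2, Thm. 2.2 (proof)] -/
theorem bijective_inclHom_compl_core (hφ : IsOpenEmbedding φ) {q₀ : Z × E} (hq₀ : q₀.2 ≠ 0) :
    Function.Bijective (inclHom (φ '' (univ ×ˢ ({0} : Set E)))ᶜ (φ q₀)
      (fun h ↦ by
        obtain ⟨q, ⟨-, hq⟩, hqq⟩ := h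
        exact hq₀ (by rw [← hφ.injective hqq]; exact hq))) := by
  set S := φ '' (univ ×ˢ ({0} : Set E)) with hSdef
  have hS : IsClosed S := isClosed_image_core hφ.continuous
  have hT : IsOpen (range φ) := hφ.isOpen_range
  have hST : S ⊆ range φ := image_subset_range _ _
  have hcov : Sᶜ ∪ range φ = univ := by
    ext w
    simp only [mem_union, mem_compl_iff, mem_univ, iff_true]
    by_cases hw : w ∈ range φ
    · exact Or.inr hw
    · exact Or.inl fun h ↦ hw (hST h)
  have hx₀S : φ q₀ ∉ S := fun h ↦ by
    obtain ⟨q, ⟨-, hq⟩, hqq⟩ := h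
    exact hq₀ (by rw [← hφ.injective hqq]; exact hq)
  have hUT : Sᶜ ∩ range φ = φ '' {q : Z × E | q.2 ∈ (({0} : Set E)ᶜ)} :=
    (image_compl_zero_eq hφ.injective).symm
  -- path-connectedness of the three pieces
  have hTpc : IsPathConnected (range φ) := by
    rw [← image_univ]; exact isPathConnected_univ.image hφ.continuous
  have hmeet : IsPathConnected (Sᶜ ∩ range φ) := by
    rw [hUT]
    refine IsPathConnected.image ?_ hφ.continuous
    have : {q : Z × E | q.2 ∈ (({0} : Set E)ᶜ)} = univ ×ˢ ({0}ᶜ : Set E) := by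
      ext q; simp
    rw [this]
    exact isPathConnected_univ.prod
      (isPathConnected_iff_pathConnectedSpace.2 inferInstance)
  have hUpc : IsPathConnected Sᶜ :=
    isPathConnected_compl_of_nbhd hS hT hST isPathConnected_univ
      (by rw [sdiff_eq, inter_comm]; exact hmeet)
  -- the isomorphic edge
  have hjT : Function.Bijective (inclHomOfSubset (inter_subset_right : Sᶜ ∩ range φ ⊆ range φ)
      (φ q₀) ⟨hx₀S, mem_range_self q₀⟩ (mem_range_self q₀)) := by
    have hmodel := bijective_inclHom_prod_of_simplyConnected (Z := Z) (B := (({0} : Set E)ᶜ))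
      (z₀ := q₀.1) (v₀ := q₀.2) hq₀
    have hinj := (injective_inclHom_iff_image_of_isEmbedding hφ.isEmbedding
      (S := {q : Z × E | q.2 ∈ (({0} : Set E)ᶜ)}) (x := q₀) hq₀).1 hmodel.1
    have hsurj := (surjective_inclHom_iff_image_of_isEmbedding hφ.isEmbedding
      (S := {q : Z × E | q.2 ∈ (({0} : Set E)ᶜ)}) (x := q₀) hq₀).1 hmodel.2
    exact ⟨(injective_inclHomOfSubset_congr' hUT.symm rfl _ _ _ _).1 hinj,
      (surjective_inclHomOfSubset_congr' hUT.symm rfl _ _ _ _).1 hsurj⟩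
  exact bijective_inclHom_of_bijective_right hS.isOpen_compl hT hcov hx₀S (mem_range_self q₀)
    hUpc hTpc hmeet hjT

omit [CompactSpace Z] [PathConnectedSpace Z] [SimplyConnectedSpace E]
  [SimplyConnectedSpace ↥(({0} : Set E)ᶜ)] [T2Space W] [PathConnectedSpace W] in
/-- A path-connected space with trivial fundamental group at one point is simply connected.
[cite: HatcherAT2002, Prop. 1.5] -/
theorem simplyConnectedSpace_of_subsingleton {X : Type*} [TopologicalSpace X]
    [PathConnectedSpace X] (x₀ : X) [Subsingleton (_root_.FundamentalGroup X x₀)] :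
    SimplyConnectedSpace X := by
  rw [simply_connected_iff_loops_nullhomotopic]
  refine ⟨inferInstance, fun x γ ↦ ?_⟩
  haveI : Subsingleton (_root_.FundamentalGroup X x) :=
    (_root_.FundamentalGroup.fundamentalGroupMulEquivOfPathConnected x x₀).toEquiv.subsingleton
  have h : _root_.FundamentalGroup.fromPath (Path.Homotopic.Quotient.mk γ) =
      _root_.FundamentalGroup.fromPath (Path.Homotopic.Quotient.mk (Path.refl x)) :=
    Subsingleton.elim _ _
  exact Path.Homotopic.Quotient.eq.1 h

/-- **The complement of the core is simply connected iff `W` is**, under the hypotheses of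
`bijective_inclHom_compl_core`. [cite: Kosinski1993, Ch. X §2, Thm. 2.2 (proof)] -/
theorem simplyConnectedSpace_compl_core_iff [Nonempty Z] (hφ : IsOpenEmbedding φ) :
    SimplyConnectedSpace ↥(φ '' (univ ×ˢ ({0} : Set E)))ᶜ ↔ SimplyConnectedSpace W := by
  obtain ⟨⟨v₀, hv₀⟩⟩ := (inferInstance : Nonempty ↥(({0} : Set E)ᶜ))
  let q₀ : Z × E := (Classical.arbitrary Z, v₀)
  have hb := bijective_inclHom_compl_core hφ (q₀ := q₀) hv₀
  have hx₀S : φ q₀ ∉ φ '' (univ ×ˢ ({0} : Set E)) := fun h ↦ by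
    obtain ⟨q, ⟨-, hq⟩, hqq⟩ := h
    have e : q.2 = v₀ := congrArg Prod.snd (hφ.injective hqq)
    exact hv₀ (e ▸ hq)
  have hUpc : IsPathConnected (φ '' (univ ×ˢ ({0} : Set E)))ᶜ := by
    have hUT := (image_compl_zero_eq (Z := Z) (E := E) hφ.injective).symm
    refine isPathConnected_compl_of_nbhd (isClosed_image_core hφ.continuous) hφ.isOpen_range
      (image_subset_range _ _) isPathConnected_univ ?_
    rw [sdiff_eq, inter_comm, hUT]
    refine IsPathConnected.image ?_ hφ.continuous
    have : {q : Z × E | q.2 ∈ (({0} : Set E)ᶜ)} = univ ×ˢ ({0}ᶜ : Set E) := by ext q; simp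
    rw [this]
    exact isPathConnected_univ.prod (isPathConnected_iff_pathConnectedSpace.2 inferInstance)
  haveI : PathConnectedSpace ↥(φ '' (univ ×ˢ ({0} : Set E)))ᶜ :=
    isPathConnected_iff_pathConnectedSpace.1 hUpc
  constructor
  · intro h
    haveI : Subsingleton (_root_.FundamentalGroup W (φ q₀)) :=
      ⟨fun a b ↦ by
        obtain ⟨a', rfl⟩ := hb.2 a
        obtain ⟨b', rfl⟩ := hb.2 b
        rw [Subsingleton.elim a' b']⟩
    exact simplyConnectedSpace_of_subsingleton (φ q₀)
  · intro h
    haveI : Subsingleton (_root_.FundamentalGroup ↥(φ '' (univ ×ˢ ({0} : Set E)))ᶜ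
        ⟨φ q₀, hx₀S⟩) := ⟨fun a b ↦ hb.1 (Subsingleton.elim _ _)⟩
    exact simplyConnectedSpace_of_subsingleton (⟨φ q₀, hx₀S⟩ : ↥(φ '' (univ ×ˢ ({0} : Set E)))ᶜ)

end Core

end VanKampen

end Literature.AlgebraicTopology.FundamentalGroup
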